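import Mathlib
import Literature.NumberTheory.Transcendental.ZilberField
import Literature.NumberTheory.Transcendental.ZilberFieldQuasiminimal
import Literature.NumberTheory.Transcendental.ZilberFieldAutomorphisms
import Literature.NumberTheory.Transcendental.GammaIsoCross
import Literature.NumberTheory.Transcendental.GammaFields
import Summits.Schanuel.Schanuel.Theorems.RigidCoreAclSubsetLogFreeCoreLogShift
import Summits.Schanuel.Schanuel.Theorems.RigidCoreAclSubsetLogFreeCoreCaseI

/-!
# Stub `stub_caseII_shiftAut` (line `eac-extends-core-automorphisms`, crux stmt-Schanuel-0968
`Summit.Schanuel.Schanuel.Theses.RigidCore.AclSubsetLogFreeCore`)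

**Case II, the branch-shifting automorphism** (zero-dimensional Zilber fields). In a Zilber field
`F` which is its own `ecl ∅`, with kernel `τℤ`: if `X = ℚτ + ℚc` is strong and `ℓ` is an L-step
over `X` (`exp ℓ` algebraic over the Γ-field `ℚ(gens X)`, `ℓ` not), then some exponential-field
automorphism `θ` of `F` fixes `c` and `τ` and shifts the branch, `θ ℓ = ℓ + m τ` with `m ≥ 1`.

Proof. The log shift `(c, ℓ) ↦ (c, ℓ + m τ)` is a Γ-isomorphism over `ℚτ`
(`Theorems.RigidCore.logShift_isGammaIso`, from the Kummer fact, with `j = 1`), restated as a cross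
Γ-isomorphism over the identity of `ℚ^{ab}(τ)` (`GammaField.isGammaIsoTw₂_iff_isGammaIsoTw`); the
two tuples span, together with `ℚτ`, the SAME strong space `X + ℚℓ` (one-element L-steps over a
strong space have predimension `0`, `predim_span_singleton_eq_zero_of_acl`). Since `ecl ∅ = univ`
is countable (CCP), `F` is a countable Zilber field, and the countable case of the
Kirby–Macintyre–Onshuus Proposition (`ZilberAutomorphisms.exists_equiv_of_isGammaIsoTw₂_of_countable`,
over `IsEBaseIso₂.refl`) realises the Γ-isomorphism by an automorphism of the exponential field
`F` which is the identity on `ℚ^{ab}(τ)` (so fixes `τ`).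

## References

* J. Kirby, A. Macintyre, A. Onshuus, *The algebraic numbers definable in various exponential
  fields*, J. Inst. Math. Jussieu 11 (2012): §3.5 Proposition.
* M. Bays, J. Kirby, *Pseudo-exponential maps, variants, and quasiminimality*, Algebra & Number
  Theory 12 (2018) 493–549: Lemma 8.3 (proof), Prop. 3.22.
-/

noncomputable section

-- the namespace `Summit.Schanuel.Schanuel.…` (problem = summit) trips the duplicated-namespace
-- linter on every declaration; the project lakefile disables it for the same reason.
set_option linter.dupNamespace false

open Set
open Literature.ModelTheory.ExponentialFields Literature.ModelTheory.ExponentialFields.ExponentialRing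
open Literature.NumberTheory.Transcendental Literature.NumberTheory.Transcendental.GammaField

namespace Summit.Schanuel.Schanuel.Theorems.RigidCore

namespace CaseIICore

variable {F : Type} [Field F] [CharZero F] [ExponentialRing F]

/-- **The base `ℚτ + ℚ(c, ℓ + x) = X + ℚℓ` of a shifted L-step over a strong `X = ℚτ + ℚc` is
strong**, for `x ∈ X` (one-element L-steps have predimension `0`).
[cite: BaysKirby2018ANT, Lemma 4.8] -/
theorem isStrong_span_snoc_add_of_Lstep {τ : F} {N : ℕ} {c : Fin N → F}
    (hXs : IsStrong (Submodule.span ℚ ({τ} : Set F) ⊔ Submodule.span ℚ (range c))) {ℓ : F}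
    (hℓexp : exp ℓ ∈ acl (gens (Submodule.span ℚ ({τ} : Set F) ⊔ Submodule.span ℚ (range c))))
    (hℓ : ℓ ∉ acl (gens (Submodule.span ℚ ({τ} : Set F) ⊔ Submodule.span ℚ (range c))))
    {x : F} (hx : x ∈ Submodule.span ℚ ({τ} : Set F) ⊔ Submodule.span ℚ (range c)) :
    IsStrong (Submodule.span ℚ ({τ} : Set F) ⊔ Submodule.span ℚ (range (Fin.snoc c (ℓ + x)))) := by
  set X : Submodule ℚ F := Submodule.span ℚ ({τ} : Set F) ⊔ Submodule.span ℚ (range c) with hXdef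
  have hℓX : ℓ ∉ X := fun h => hℓ (subset_acl _ (mem_gens_of_mem h))
  -- `X + ℚℓ` is strong
  have hV : IsStrong (X ⊔ Submodule.span ℚ {ℓ}) := by
    refine hXs.of_predim_eq_zero le_sup_left
      (isFG_sup_left.2 (isFG_span_of_finite X (finite_singleton ℓ))) ?_
    rw [predim_sup_left]
    exact predim_span_singleton_eq_zero_of_acl hXs hℓX (Or.inr hℓexp)
  -- and it is the space in question
  have h1 : Submodule.span ℚ ({τ} : Set F) ⊔ Submodule.span ℚ (range (Fin.snoc c (ℓ + x))) =
      X ⊔ Submodule.span ℚ {ℓ + x} := by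
    rw [Fin.range_snoc, Submodule.span_insert, sup_left_comm, sup_comm, hXdef]
  have h2 : X ⊔ Submodule.span ℚ {ℓ + x} = X ⊔ Submodule.span ℚ {ℓ} := by
    apply le_antisymm
    · refine sup_le le_sup_left ((Submodule.span_singleton_le_iff_mem _ _).2 ?_)
      exact add_mem (Submodule.mem_sup_right (Submodule.mem_span_singleton_self ℓ))
        (Submodule.mem_sup_left hx)
    · refine sup_le le_sup_left ((Submodule.span_singleton_le_iff_mem _ _).2 ?_)
      have h := sub_mem (Submodule.mem_sup_right (Submodule.mem_span_singleton_self (ℓ + x)))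
        (Submodule.mem_sup_left hx : x ∈ X ⊔ Submodule.span ℚ {ℓ + x})
      rwa [add_sub_cancel_right] at h
  rw [h1, h2]
  exact hV

end CaseIICore

/-- **Stub `stub_caseII_shiftAut` — Case II, the branch-shifting automorphism** (zero-dimensional
Zilber fields). In a Zilber field `F` which is its own `ecl ∅`, with kernel `τℤ`: if `X = ℚτ + ℚc`
is strong and `ℓ` is an L-step over `X` (`exp ℓ` algebraic over the Γ-field `ℚ(gens X)`, `ℓ`
not), then some exponential-field automorphism `θ` of `F` fixes `c` and `τ` and shifts the branch,
`θ ℓ = ℓ + m τ` with `m ≥ 1`. Route: the log shift `(c, ℓ) ↦ (c, ℓ + m τ)` is a Γ-isomorphism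
over `ℚτ` (`logShift_isGammaIso`, Kummer), between tuples spanning the same strong space `X + ℚℓ`;
`F = ecl ∅` is countable (CCP), so the countable KMO Proposition
(`ZilberAutomorphisms.exists_equiv_of_isGammaIsoTw₂_of_countable`) realises it by an automorphism
of the exponential field which is the identity on `ℚ^{ab}(τ)`.
[cite: KirbyMacintyreOnshuus2012, §3.5 Proposition]
[cite: BaysKirby2018ANT, Lemma 8.3 (proof), Prop. 3.22] -/
theorem stub_caseII_shiftAut {F : Type} [Field F] [CharZero F] [ExponentialRing F]
    (hE : IsZilberField F) (huniv : ecl (∅ : Set F) = Set.univ)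
    {τ : F} (hker : expKernel F = AddSubgroup.zmultiples τ)
    {N : ℕ} (c : Fin N → F)
    (hXs : IsStrong (Submodule.span ℚ ({τ} : Set F) ⊔ Submodule.span ℚ (range c)))
    {ℓ : F} (hℓexp : exp ℓ ∈ acl (gens (Submodule.span ℚ ({τ} : Set F) ⊔ Submodule.span ℚ (range c))))
    (hℓ : ℓ ∉ acl (gens (Submodule.span ℚ ({τ} : Set F) ⊔ Submodule.span ℚ (range c)))) :
    ∃ (θ : F ≃+* F) (m : ℕ), 0 < m ∧ (∀ x, θ (exp x) = exp (θ x)) ∧ (∀ j, θ (c j) = c j) ∧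
      θ τ = τ ∧ θ ℓ = ℓ + (m : ℚ) • τ := by
  classical
  -- `F = ecl ∅` is countable by CCP
  haveI : Countable F := by
    have h := hE.hasCountableClosureProperty ∅ countable_empty
    rw [huniv] at h
    exact Set.countable_univ_iff.1 h
  -- `τ ≠ 0`: the kernel is generated by a transcendental element
  have hτ0 : τ ≠ 0 := by
    obtain ⟨τ', hτ't, hker'⟩ := hE.hasStandardKernel
    intro h0
    apply hτ't
    have hmem : τ' ∈ AddSubgroup.zmultiples τ := by
      rw [← hker, hker']; exact AddSubgroup.mem_zmultiples τ'
    rw [h0, AddSubgroup.zmultiples_zero_eq_bot, AddSubgroup.mem_bot] at hmem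
    rw [hmem]
    exact isAlgebraic_zero
  -- the log shift, a Γ-isomorphism over `ℚτ`
  obtain ⟨m, hm, hiso⟩ := logShift_isGammaIso hker c ℓ hℓexp hℓ
  have h1 : IsGammaIso (Submodule.span ℚ ({τ} : Set F)) (Fin.snoc c ℓ)
      (Fin.snoc c (ℓ + (m : F) * τ)) := by
    have := hiso 1
    rwa [Int.cast_one, mul_one] at this
  have hiso₂ : IsGammaIsoTw₂ (RingEquiv.refl (fieldOf (Submodule.span ℚ ({τ} : Set F))))
      (Fin.snoc c ℓ) (Fin.snoc c (ℓ + (m : F) * τ)) :=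
    isGammaIsoTw₂_iff_isGammaIsoTw.2 h1.isGammaIsoTw_refl
  -- both tuples span, with `ℚτ`, the strong space `X + ℚℓ`
  have hτX : τ ∈ Submodule.span ℚ ({τ} : Set F) ⊔ Submodule.span ℚ (range c) :=
    Submodule.mem_sup_left (Submodule.subset_span rfl)
  have hmτX : (m : F) * τ ∈ Submodule.span ℚ ({τ} : Set F) ⊔ Submodule.span ℚ (range c) := by
    have := (Submodule.span ℚ ({τ} : Set F) ⊔ Submodule.span ℚ (range c)).smul_of_tower_mem m hτX
    rwa [nsmul_eq_mul] at this
  have hs : IsStrong (Submodule.span ℚ ({τ} : Set F) ⊔ Submodule.span ℚ (range (Fin.snoc c ℓ))) := by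
    have := CaseIICore.isStrong_span_snoc_add_of_Lstep hXs hℓexp hℓ (Submodule.zero_mem _)
    rwa [add_zero] at this
  have hs' : IsStrong (Submodule.span ℚ ({τ} : Set F) ⊔
      Submodule.span ℚ (range (Fin.snoc c (ℓ + (m : F) * τ)))) :=
    CaseIICore.isStrong_span_snoc_add_of_Lstep hXs hℓexp hℓ hmτX
  -- the countable KMO Proposition
  obtain ⟨ρ, hρc, hρk⟩ := ZilberAutomorphisms.exists_equiv_of_isGammaIsoTw₂_of_countable hE hker
    hker hτ0 hτ0 (IsEBaseIso₂.refl _) hiso₂ hs hs'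
  refine ⟨ρ.toRingEquiv, m, hm, fun x => ?_, fun j => ?_, ?_, ?_⟩
  · rw [ExponentialRingEquiv.coe_toRingEquiv]
    exact ρ.map_exp x
  · have h := hρc (Fin.castSucc j)
    rwa [Fin.snoc_castSucc, Fin.snoc_castSucc] at h
  · exact hρk ⟨τ, mem_fieldOf_of_mem (Submodule.mem_span_singleton_self τ)⟩
  · have h := hρc (Fin.last N)
    rw [Fin.snoc_last, Fin.snoc_last] at h
    rw [ExponentialRingEquiv.coe_toRingEquiv, h, Nat.cast_smul_eq_nsmul, nsmul_eq_mul]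

end Summit.Schanuel.Schanuel.Theorems.RigidCore
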